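import Mathlib
import Summits.ValiantsHypothesis.ValiantsHypothesis.Theorems.ProofCarryingSymmetryRestorationQPConstNormAC
import Summits.ValiantsHypothesis.ValiantsHypothesis.Theorems.ProofCarryingSymmetryRestorationQPConstNormSubs
import Summits.ValiantsHypothesis.ValiantsHypothesis.Theorems.ProofCarryingSymmetryRestorationQPUnitStability

/-!
# Route ProofCarryingSymmetry — crux `RestorationQP`, line `registered`, rung S3⁗ under stub S2″ (`stub_proofsToACEquiv`), part 7:
stability when invariance proofs avoid only distributivity

Continuation of parts 1–6 (`UCEq`, `cnorm`, `acEq_cnorm_of_ucEq`, `cnormClass`).  If for every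
`σ ∈ S_n` the unfoldings `(C ∘ σ)•` and `C•` of a Hrubeš–Tzameret circuit are inter-derivable in
`P_f(ℂ)` WITHOUT DISTRIBUTIVITY A6 — commutativity, associativity, the unit laws A7–A9 and the constant
equations A10 all being allowed — then `UCEq (C ∘ σ)• C•` (soundness, part 1), so the constant-folding
normal forms are AC-equivalent (key lemma, part 5) and, `cnorm` commuting with renaming,
`σ • cnormClass C = cnormClass C`.  The S3″ pipeline applied to `cnormClass C` (≤ `3(|C|+1)` reachable
classes, multiplicities `< 2^(|C|+3)`, part 6) gives an `S_n`-symmetric Dawar–Wilsenach circuit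
computing `Ĉ` of size `≤ (|C| + n + 2)^6`.

* `stabilityAtDistEquiv` — rung S3⁗ in the `P_f`-phrasing (budget `0` on A6 only);
* `stabilityAtDistBudget` — the same from `P_c` proofs of the presentations `C ∘ σ = C`;
* `proofsToACEquiv_of_proofsToDistEquiv` — the correspondingly WEAKENED bet S2⁗ (invariance proofs
  ⇒ a poly-larger circuit whose renamed unfoldings are inter-derivable with its unfolding without A6)
  implies the registered bet S2″ `stub_proofsToACEquiv`: the line's bet is now PURE DISTRIBUTIVITY
  ELIMINATION from invariance proofs.

Everything proved; no named facts.
-/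

-- single-problem summit: `Summit.ValiantsHypothesis.ValiantsHypothesis.…` is the namespace by design (D-0017)
set_option linter.dupNamespace false

noncomputable section

open scoped Classical

namespace Summit.ValiantsHypothesis.ValiantsHypothesis.Theorems

namespace ACStability

open Literature.Computability.AlgebraicComplexity ACClass

universe u v

variable {𝔽 : Type u} [CommSemiring 𝔽] [Nontrivial 𝔽] {X : Type v}

/-- **UC-equivalent renamed unfoldings fix the constant-normal class.** [folklore] -/
theorem cnormClass_smul_eq_of_ucEq {Γ : Type*} [Group Γ] [MulAction Γ X] {γ : Γ} {C : PICircuit 𝔽 X}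
    (h : UCEq (C.rename fun x => γ • x).unfold C.unfold) : γ • cnormClass C = cnormClass C := by
  rw [smul_cnormClass]
  exact mk_eq_mk.2 (acEq_cnorm_of_ucEq h)

/-- **Rung S3⁗, generic core.** If the renamed unfoldings `(C ∘ γ)•`, `γ ∈ Γ`, are UC-equivalent to
`C•` (constants with `0 ≠ 1`), the AC-canonical circuit of `cnormClass C` with chain length `|C| + 3`
is a `Γ`-symmetric labelled arithmetic circuit computing `Ĉ` with at most
`6(|C|+1) + 18(|C|+3)(|C|+1)²` gates. [folklore] -/
theorem exists_isSymmetric_of_ucEq {Γ : Type*} [Group Γ] [MulAction Γ X]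
    (C : PICircuit 𝔽 X) (h : ∀ γ : Γ, UCEq (C.rename fun x => γ • x).unfold C.unfold) :
    ∃ (G : Type (max u v)) (_ : Fintype G) (D : LabelledArithCircuit 𝔽 X Unit G),
      D.IsSymmetric Γ ∧ D.eval (D.output ()) = C.eval ∧
      Fintype.card G ≤ 2 * (3 * (C.size + 1)) + 2 * (C.size + 3) * (3 * (C.size + 1)) ^ 2 := by
  have hL : ∀ q ∈ reach (cnormClass C), Multiset.card q.kids < 2 ^ (C.size + 3) :=
    fun _ hq => card_kids_lt_of_mem_reach_cnormClass hq
  have ht : ∀ γ : Γ, γ • cnormClass C = cnormClass C := fun γ => cnormClass_smul_eq_of_ucEq (h γ)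
  exact ⟨ACGate (cnormClass C) (C.size + 3), inferInstance, acCircuit (cnormClass C) (C.size + 3) hL,
    isSymmetric_acCircuit hL ht, (eval_output_acCircuit hL).trans (eval_cnormClass C),
    card_acGate_le (3 * (C.size + 1)) (card_reach_cnormClass_le C)⟩

omit [CommSemiring 𝔽] [Nontrivial 𝔽] in
/-- The gate count is `≤ (|C| + n + 2)^6`. [folklore] -/
theorem dist_gate_bound (s n : ℕ) :
    2 * (3 * (s + 1)) + 2 * (s + 3) * (3 * (s + 1)) ^ 2 ≤ (s + n + 2) ^ 6 := by
  have h1 : 2 * (3 * (s + 1)) + 2 * (s + 3) * (3 * (s + 1)) ^ 2 ≤ 64 * (s + 1) ^ 3 := by nlinarith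
  have h2 : 4 * (s + 1) ≤ (s + 2) ^ 2 := by nlinarith
  have h3 : 64 * (s + 1) ^ 3 ≤ (s + 2) ^ 6 := by
    calc 64 * (s + 1) ^ 3 = (4 * (s + 1)) ^ 3 := by ring
      _ ≤ ((s + 2) ^ 2) ^ 3 := Nat.pow_le_pow_left h2 3
      _ = (s + 2) ^ 6 := by ring
  calc 2 * (3 * (s + 1)) + 2 * (s + 3) * (3 * (s + 1)) ^ 2 ≤ (s + 2) ^ 6 := h1.trans h3
    _ ≤ (s + n + 2) ^ 6 := Nat.pow_le_pow_left (by omega) 6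

end ACStability

open Literature.Computability.AlgebraicComplexity

/-- **Rung S3⁗ — stability when invariance proofs avoid only distributivity** (helper under the
registered stub S2″ `stub_proofsToACEquiv` of the line `registered` of crux `RestorationQP`, item
stmt-ValiantsHypothesis-10343): if for every `σ ∈ S_n` the unfoldings `(C ∘ σ)•` and `C•` of a
Hrubeš–Tzameret circuit `C` over `ℂ` in the matrix variables are inter-derivable in `P_f(ℂ)` using
A1–A5, the unit laws A7–A9, the constant equations A10 and the rules (no distributivity A6), then the
AC-canonical circuit of the constant-normal class of `C` is an `S_n`-symmetric labelled arithmetic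
circuit (Dawar–Wilsenach Def. 3.7) computing `Ĉ`, of size `≤ (|C| + n + 2)^6`. [folklore] -/
theorem stabilityAtDistEquiv : ∃ c : ℕ, ∀ (n : ℕ) (C : PICircuit ℂ (Fin n × Fin n)), (∀ σ : Equiv.Perm (Fin n), (pfSystem ℂ (Fin n × Fin n)).Provable (C.rename fun x : Fin n × Fin n => σ • x).unfold C.unfold ⊤ (fun s => if s = PIAxiom.A6 then 0 else ⊤)) → ∃ (G : Type) (_ : Fintype G) (D : LabelledArithCircuit ℂ (Fin n × Fin n) Unit G), D.IsSymmetric (Equiv.Perm (Fin n)) ∧ D.eval (D.output ()) = C.eval ∧ Fintype.card G ≤ (C.size + n + 2) ^ c := by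
  refine ⟨6, fun n C h => ?_⟩
  obtain ⟨G, hG, D, hsym, hev, hcard⟩ :=
    ACStability.exists_isSymmetric_of_ucEq (Γ := Equiv.Perm (Fin n)) C
      fun σ => ACStability.ucEq_of_pfProvable (fun s hs => if_pos hs) (h σ)
  exact ⟨G, hG, D, hsym, hev, hcard.trans (ACStability.dist_gate_bound C.size n)⟩

/-- **Rung S3⁗ from `P_c` proofs**: if every invariance identity `C ∘ σ = C`, `σ ∈ S_n`, has a
`P_c(ℂ)`-proof using no instance of distributivity A6 — A1–A5, A7–A10, C1, C2 and the rules allowed —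
then an `S_n`-symmetric labelled arithmetic circuit of size `≤ (|C| + n + 2)^6` computes `Ĉ`.
[folklore] -/
theorem stabilityAtDistBudget : ∃ c : ℕ, ∀ (n : ℕ) (C : PICircuit ℂ (Fin n × Fin n)), (∀ σ : Equiv.Perm (Fin n), HasPCProof (C.rename fun x : Fin n × Fin n => σ • x) C (fun s => if s = PIAxiom.A6 then 0 else ⊤)) → ∃ (G : Type) (_ : Fintype G) (D : LabelledArithCircuit ℂ (Fin n × Fin n) Unit G), D.IsSymmetric (Equiv.Perm (Fin n)) ∧ D.eval (D.output ()) = C.eval ∧ Fintype.card G ≤ (C.size + n + 2) ^ c := by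
  refine ⟨6, fun n C h => ?_⟩
  obtain ⟨G, hG, D, hsym, hev, hcard⟩ :=
    ACStability.exists_isSymmetric_of_ucEq (Γ := Equiv.Perm (Fin n)) C
      fun σ => ACStability.ucEq_unfold_of_hasPCProof (fun s hs => if_pos hs) (h σ)
  exact ⟨G, hG, D, hsym, hev, hcard.trans (ACStability.dist_gate_bound C.size n)⟩

/-- **The weakened bet S2⁗ implies the registered bet S2″.** If size-`t` proofs of all invariance
identities of `C` yield a circuit `C₁` for `Ĉ` of size `≤ (|C|+t+n+2)^c` whose renamed unfoldings are
inter-derivable with `C₁•` in `P_f(ℂ)` without distributivity A6, then they also yield a circuit `C'`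
for `Ĉ` of size `≤ (|C|+t+n+2)^(3(c+2)·6+1)` whose renamed unfoldings are inter-derivable with `C'•`
without A6–A10 (`stabilityAtDistEquiv`, then the layout `ACStability.exists_piCircuit_of_isSymmetric`
and `ACStability.pfProvable_of_acEq`): the line's bet is reduced to distributivity elimination.
[folklore] -/
theorem proofsToACEquiv_of_proofsToDistEquiv : (∃ c : ℕ, ∀ (n t : ℕ) (C : PICircuit ℂ (Fin n × Fin n)), (∀ σ : Equiv.Perm (Fin n), HasPCProofOfSize (C.rename fun x : Fin n × Fin n => σ • x) C t) → ∃ C' : PICircuit ℂ (Fin n × Fin n), C'.eval = C.eval ∧ C'.size ≤ (C.size + t + n + 2) ^ c ∧ ∀ σ : Equiv.Perm (Fin n), (pfSystem ℂ (Fin n × Fin n)).Provable (C'.rename fun x : Fin n × Fin n => σ • x).unfold C'.unfold ⊤ (fun s => if s = PIAxiom.A6 then 0 else ⊤)) → (∃ c : ℕ, ∀ (n t : ℕ) (C : PICircuit ℂ (Fin n × Fin n)), (∀ σ : Equiv.Perm (Fin n), HasPCProofOfSize (C.rename fun x : Fin n × Fin n => σ • x) C t) → ∃ C' : PICircuit ℂ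 (Fin n × Fin n), C'.eval = C.eval ∧ C'.size ≤ (C.size + t + n + 2) ^ c ∧ ∀ σ : Equiv.Perm (Fin n), (pfSystem ℂ (Fin n × Fin n)).Provable (C'.rename fun x : Fin n × Fin n => σ • x).unfold C'.unfold ⊤ (fun s => if s = PIAxiom.A6 ∨ s = PIAxiom.A7 ∨ s = PIAxiom.A8 ∨ s = PIAxiom.A9 ∨ s = PIAxiom.A10 then 0 else ⊤)) := by
  rintro ⟨c, hc⟩
  obtain ⟨c₃, h₃⟩ := stabilityAtDistEquiv
  refine ⟨3 * ((c + 2) * c₃) + 1, fun n t C hC => ?_⟩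
  obtain ⟨C₁, hC₁ev, hC₁size, hC₁pf⟩ := hc n t C hC
  obtain ⟨G, hG, D, hsym, hev, hcard⟩ := h₃ n C₁ hC₁pf
  obtain ⟨C', -, hC'ev, hC'size, hC'ac⟩ :=
    ACStability.exists_piCircuit_of_isSymmetric (Γ := Equiv.Perm (Fin n)) D hsym () (fun _ => rfl)
  refine ⟨C', hC'ev.trans (hev.trans hC₁ev), ?_, fun σ => ACStability.pfProvable_of_acEq (hC'ac σ)⟩
  refine hC'size.trans ?_
  set m : ℕ := C.size + t + n + 2 with hm
  set K : ℕ := (c + 2) * c₃ with hK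
  have hm3 : 3 ≤ m := by have := C.one_le_size; omega
  have hG' : Fintype.card G ≤ m ^ K :=
    calc Fintype.card G ≤ (C₁.size + n + 2) ^ c₃ := hcard
      _ ≤ (m ^ c + n + 2) ^ c₃ := Nat.pow_le_pow_left (by omega) _
      _ ≤ m ^ K := ACStability.poly_absorb' c c₃ C.size t n C.one_le_size
  calc Fintype.card G * Fintype.card G * (Fintype.card G + 2)
      ≤ m ^ K * m ^ K * (m ^ K + 2) :=
        Nat.mul_le_mul (Nat.mul_le_mul hG' hG') (Nat.add_le_add_right hG' 2)
    _ ≤ m ^ (3 * K + 1) := ACStability.pow_cube_bound m K hm3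

end Summit.ValiantsHypothesis.ValiantsHypothesis.Theorems

end
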